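import Summits.NavierStokesRegularity.NavierStokesRegularity.Theorems.BoundedTemperatureClosed.Negative.ZeroDatumTools

/-!
# Crux `BoundedTemperatureClosed` (stmt-NavierStokesRegularity-18303), negative side:
# the crux entails — and at the zero datum is — a Navier–Stokes Type-I dichotomy

Negative-side support lemmas of the line lead (line `Sketch`, stub `stub_attain`). Write
`K = {M : Navier–Stokes has a Schwartz-data H¹⁰_df-mild Type-I blow-up of ceiling M with no mild
extension}` (an up-set of positive reals, `ZeroDatumTools`). For an averaging datum with identically
vanishing form (`exists_form_eq_zero`: symmetric and cancelling) the segment is `T_θ = θ·B`, the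
bounded-temperature blow-up set at ceiling `M` is `{θ ∈ (0,1] : θM ∈ K}`, and `θ = 0` is never a member.
Hence:

Closedness at such a datum forces attainment and a temperature floor (`ZeroDatumTools`:
`nsTypeI_of_forall_lt`, `not_forall_pos_nsTypeI`).
* `nsTypeI_dichotomy_of_isClosed` / `nsTypeI_dichotomy_of_boundedTemperatureClosed` — so the crux
  implies the dichotomy `K = ∅ ∨ ∃ m* > 0, K = [m*, ∞)`: "Navier–Stokes has no Schwartz-data
  `H¹⁰_df`-mild Type-I blow-up, or it has a COLDEST one".
* `isClosed_btSet_of_form_eq_zero` — conversely the dichotomy gives closedness at every form-zero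
  datum, so at the zero datum the crux is EQUIVALENT to the dichotomy (`isClosed_btSet_zeroDatum_iff`).
* `not_boundedTemperatureClosed_of_noColdest` — contrapositive: a Schwartz-data mild Type-I blow-up of
  Navier–Stokes without a coldest one refutes the crux.

Both sides of the dichotomy are open (Type-I exclusion for Navier–Stokes is open; nothing is known about
attainment of the infimal Type-I constant), and the route's deciding theorem `closes` uses the crux only
at the Door's datum, at `θ → 1`, discarding the Type-I bound — so this instance is foreign to the line:
the crux is over-quantified (`∀ 𝒜 ∀ M`), as flagged by the refuters' repair `BoundedTemperatureClosedAtOne`.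

## References

* T. Tao, J. Amer. Math. Soc. 29 (2016), arXiv:1402.0290v3, §1.1 (1.13), (1.15). [`Tao2016AveragedNS`]
* G. Koch, N. Nadirashvili, G. Seregin, V. Šverák, Acta Math. 203 (2009), §1 (Type-I exclusion is
  open). [`KochNadirashviliSereginSverak2009`]
-/

noncomputable section

-- the nested summit namespace `…NavierStokesRegularity.NavierStokesRegularity…` is the tree's layout
-- (D-0017), so the duplicated-namespace linter must be silenced for every declaration below
set_option linter.dupNamespace false

namespace Summit.NavierStokesRegularity.NavierStokesRegularity.Theorems.BoundedTemperatureClosed.Negative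

open MeasureTheory Set Filter Topology
open scoped ENNReal
open Literature.Analysis.FluidPDE Literature.Analysis.FluidPDE.Tao2016
open Summit.NavierStokesRegularity.NavierStokesRegularity.Theses.PumpContinuation

/-- The bounded-temperature blow-up set of the datum `𝒜` at ceiling `M` along the segment
`T_θ = (1-θ)·B̃_𝒜 + θ·B` — verbatim the set whose closedness the crux asserts. -/
local notation3 "btSet[" 𝒜 ", " M "]" =>
  {θ : ℝ | θ ∈ Set.Icc (0 : ℝ) 1 ∧
    ∃ u₀ : SchwartzMap (EuclideanSpace ℝ (Fin 3)) (EuclideanSpace ℝ (Fin 3)),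
      Literature.Analysis.FluidPDE.VectorCalculus.IsDivFree ⇑u₀ ∧ ∃ S : ℝ, 0 < S ∧
      ∃ u : ℝ → Literature.Analysis.FluidPDE.Tao2016.L2C,
        Literature.Analysis.FluidPDE.Tao2016.IsMildSolutionFor
          (fun a b c => ((1 - θ : ℝ) : ℂ) * AveragingDatum.form 𝒜 a b c +
            ((θ : ℝ) : ℂ) * Literature.Analysis.FluidPDE.Tao2016.eulerForm a b c)
          (Literature.Analysis.FluidPDE.Tao2016.schwartzL2 u₀) (Set.Ico 0 S) u ∧
        (∀ t ∈ Set.Ico 0 S, MeasureTheory.eLpNorm (u t) ⊤ MeasureTheory.volume ≤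
          ENNReal.ofReal (M / Real.sqrt (S - t))) ∧
        ¬ ∃ S' : ℝ, S < S' ∧ ∃ v : ℝ → Literature.Analysis.FluidPDE.Tao2016.L2C,
          Literature.Analysis.FluidPDE.Tao2016.IsMildSolutionFor
            (fun a b c => ((1 - θ : ℝ) : ℂ) * AveragingDatum.form 𝒜 a b c +
              ((θ : ℝ) : ℂ) * Literature.Analysis.FluidPDE.Tao2016.eulerForm a b c)
            (Literature.Analysis.FluidPDE.Tao2016.schwartzL2 u₀) (Set.Ico 0 S') v ∧
          ∀ t ∈ Set.Ico 0 S, v t = u t}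

/-- **Navier–Stokes has a Schwartz-data `H¹⁰_df`-mild Type-I blow-up at ceiling `M`** (no mild
extension): the membership predicate of the crux's set at the Euler end `θ = 1`. -/
local notation3 "nsTypeI[" M "]" =>
  ∃ u₀ : SchwartzMap (EuclideanSpace ℝ (Fin 3)) (EuclideanSpace ℝ (Fin 3)),
    Literature.Analysis.FluidPDE.VectorCalculus.IsDivFree ⇑u₀ ∧ ∃ S : ℝ, 0 < S ∧
    ∃ u : ℝ → Literature.Analysis.FluidPDE.Tao2016.L2C,
      Literature.Analysis.FluidPDE.Tao2016.IsMildSolutionFor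
        Literature.Analysis.FluidPDE.Tao2016.eulerForm
        (Literature.Analysis.FluidPDE.Tao2016.schwartzL2 u₀) (Set.Ico 0 S) u ∧
      (∀ t ∈ Set.Ico 0 S, MeasureTheory.eLpNorm (u t) ⊤ MeasureTheory.volume ≤
        ENNReal.ofReal (M / Real.sqrt (S - t))) ∧
      ¬ ∃ S' : ℝ, S < S' ∧ ∃ v : ℝ → Literature.Analysis.FluidPDE.Tao2016.L2C,
        Literature.Analysis.FluidPDE.Tao2016.IsMildSolutionFor
          Literature.Analysis.FluidPDE.Tao2016.eulerForm
          (Literature.Analysis.FluidPDE.Tao2016.schwartzL2 u₀) (Set.Ico 0 S') v ∧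
        ∀ t ∈ Set.Ico 0 S, v t = u t

/-- **The Navier–Stokes Type-I dichotomy**: either there is no Schwartz-data `H¹⁰_df`-mild Type-I
blow-up at any ceiling, or there is a coldest one — a ceiling `m > 0` such that the admissible ceilings
are exactly `[m, ∞)`. -/
local notation3 "nsDichotomy" =>
  (∀ M : ℝ, ¬ nsTypeI[M]) ∨ ∃ m : ℝ, 0 < m ∧ ∀ M : ℝ, (nsTypeI[M] ↔ m ≤ M)

/-! ### The dichotomy -/

/-- **Closedness at a form-zero datum implies the Navier–Stokes Type-I dichotomy.** The admissible
ceilings `K` form an up-set of positive reals (`pos_of_nsTypeI`, `nsTypeI_mono`); if `K ≠ ∅` its infimum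
`m*` is positive by the temperature floor and belongs to `K` by attainment, so `K = [m*, ∞)`.
[cite: KochNadirashviliSereginSverak2009, §1] -/
theorem nsTypeI_dichotomy_of_isClosed {𝒜 : AveragingDatum} (h0 : ∀ u v w : L2C, 𝒜.form u v w = 0)
    (hcl : ∀ M : ℝ, IsClosed btSet[𝒜, M]) : nsDichotomy := by
  by_cases hex : ∃ M : ℝ, nsTypeI[M]
  · right
    set K : Set ℝ := {M : ℝ | nsTypeI[M]} with hK
    have hne : K.Nonempty := hex
    have hbdd : BddBelow K := ⟨0, fun M hM => (pos_of_nsTypeI hM).le⟩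
    have hs0 : 0 ≤ sInf K := le_csInf hne fun M hM => (pos_of_nsTypeI hM).le
    -- every ceiling above the infimum is admissible
    have habove : ∀ M : ℝ, sInf K < M → nsTypeI[M] := fun M hM => by
      obtain ⟨M', hM'K, hM'M⟩ := exists_lt_of_csInf_lt hne hM
      exact nsTypeI_mono hM'M.le hM'K
    rcases hs0.eq_or_lt with hzero | hpos
    · exact absurd (fun M hM => habove M (by rwa [← hzero])) (not_forall_pos_nsTypeI h0 hcl)
    · refine ⟨sInf K, hpos, fun M => ⟨fun hM => csInf_le hbdd hM, fun hle => ?_⟩⟩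
      rcases hle.eq_or_lt with heq | hlt
      · rw [← heq]
        exact nsTypeI_of_forall_lt h0 hcl hpos habove
      · exact habove M hlt
  · left
    exact fun M hM => hex ⟨M, hM⟩

/-- **The crux implies the Navier–Stokes Type-I dichotomy** (apply it at the zero averaging datum,
`exists_form_eq_zero`): `BoundedTemperatureClosed` as quantified (`∀ 𝒜 ∀ M`) proves "Navier–Stokes has
no Schwartz-data `H¹⁰_df`-mild Type-I blow-up, or a coldest one" — an open statement (Type-I exclusion
for Navier–Stokes is open, KNSS 2009 §1) foreign to the route's `closes`.
[cite: KochNadirashviliSereginSverak2009, §1] -/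
theorem nsTypeI_dichotomy_of_boundedTemperatureClosed (hC : BoundedTemperatureClosed) : nsDichotomy := by
  obtain ⟨𝒜, hs, hc, h0⟩ := exists_form_eq_zero
  exact nsTypeI_dichotomy_of_isClosed h0 (hC 𝒜 hs hc)

/-- **Contrapositive: no coldest blow-up refutes the crux.** If Navier–Stokes has a Schwartz-data
`H¹⁰_df`-mild Type-I blow-up, and below every admissible ceiling there is a strictly smaller admissible
one, then `BoundedTemperatureClosed` fails (at the zero datum). [cite: KochNadirashviliSereginSverak2009, §1] -/
theorem not_boundedTemperatureClosed_of_noColdest (hex : ∃ M : ℝ, nsTypeI[M])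
    (hno : ∀ m : ℝ, nsTypeI[m] → ∃ M : ℝ, M < m ∧ nsTypeI[M]) : ¬ BoundedTemperatureClosed := by
  intro hC
  rcases nsTypeI_dichotomy_of_boundedTemperatureClosed hC with hnone | ⟨m, -, hiff⟩
  · obtain ⟨M, hM⟩ := hex
    exact hnone M hM
  · obtain ⟨M, hMm, hM⟩ := hno m ((hiff m).2 le_rfl)
    exact absurd ((hiff M).1 hM) (not_le.2 hMm)

/-! ### Conversely: the dichotomy gives closedness at every form-zero datum -/

/-- **The dichotomy implies closedness at a form-zero datum.** If `K = ∅` the set is empty; if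
`K = [m, ∞)` with `m > 0` the set is `[0,1] ∩ {θ : m ≤ θ M}` (the member test at `θ > 0` is `θM ∈ K`,
and `θ = 0` fails both membership and `m ≤ 0·M`) — closed either way. [cite: Tao2016AveragedNS, §1.1 (1.15)] -/
theorem isClosed_btSet_of_form_eq_zero {𝒜 : AveragingDatum} (h0 : ∀ u v w : L2C, 𝒜.form u v w = 0)
    (hD : nsDichotomy) (M : ℝ) : IsClosed btSet[𝒜, M] := by
  rcases hD with hnone | ⟨m, hm, hiff⟩
  · have hset : btSet[𝒜, M] = ∅ := by
      refine Set.eq_empty_iff_forall_notMem.2 fun θ hθ => ?_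
      rcases hθ.1.1.eq_or_lt with hz | hpos
      · exact zero_not_mem_btSet_of_form_eq_zero h0 M (by rwa [← hz] at hθ)
      · exact hnone _ ((mem_btSet_iff_of_form_eq_zero h0 hpos hθ.1.2 M).1 hθ)
    rw [hset]
    exact isClosed_empty
  · have hset : btSet[𝒜, M] = Icc (0 : ℝ) 1 ∩ {θ : ℝ | m ≤ θ * M} := by
      ext θ
      constructor
      · intro hθ
        refine ⟨hθ.1, ?_⟩
        rcases hθ.1.1.eq_or_lt with hz | hpos
        · exact absurd (by rwa [← hz] at hθ) (zero_not_mem_btSet_of_form_eq_zero h0 M)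
        · exact (hiff _).1 ((mem_btSet_iff_of_form_eq_zero h0 hpos hθ.1.2 M).1 hθ)
      · rintro ⟨hθI, hθm⟩
        have hpos : 0 < θ := by
          rcases hθI.1.eq_or_lt with hz | hpos
          · exfalso
            rw [mem_setOf_eq, ← hz, zero_mul] at hθm
            exact absurd hθm (not_le.2 hm)
          · exact hpos
        exact (mem_btSet_iff_of_form_eq_zero h0 hpos hθI.2 M).2 ((hiff _).2 hθm)
    rw [hset]
    exact isClosed_Icc.inter (isClosed_le continuous_const (continuous_id.mul continuous_const))

/-- **At the zero datum the crux IS the Navier–Stokes Type-I dichotomy.** For every averaging datum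
with identically vanishing form: all its bounded-temperature blow-up sets are closed iff Navier–Stokes has
no Schwartz-data `H¹⁰_df`-mild Type-I blow-up or a coldest one. [cite: Tao2016AveragedNS, §1.1 (1.15)] -/
theorem isClosed_btSet_zeroDatum_iff {𝒜 : AveragingDatum} (h0 : ∀ u v w : L2C, 𝒜.form u v w = 0) :
    (∀ M : ℝ, IsClosed btSet[𝒜, M]) ↔ nsDichotomy :=
  ⟨nsTypeI_dichotomy_of_isClosed h0, fun hD M => isClosed_btSet_of_form_eq_zero h0 hD M⟩

end Summit.NavierStokesRegularity.NavierStokesRegularity.Theorems.BoundedTemperatureClosed.Negative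

end
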